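import Summits.QuantumFields.BalabanUV.Beta.GAN24.FineReadoutDecay
import Summits.QuantumFields.BalabanUV.Beta.GAN24.FineReadoutGradient
import Literature.MathematicalPhysics.QuantumFieldTheory.Balaban1983to89.B4Green244
import Literature.MathematicalPhysics.QuantumFieldTheory.Balaban1983to89.B4Green242Bridge

/-!
# Beta / RemainderExplicitGradient — BINDER-OWNERS row D4, ROAD P3 (co-owner #3, unit `b2b-balaban-beta-d4-p3`), skeleton
# leaf E3.2: THE LATTICE GRADIENT OF THE TYPED `U = 1` MINIMISER COLUMN GAINS ONE `1/N`, LEVEL-UNIFORMLY —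
# `|wH(z + e_ν) − wH(z)| ≤ C · N^{−(d+2)} · N⁻¹ · e^{−κ₀‖quo_N z‖∞}` for EVERY `N = Lc^{j+1}` at `d + 1 = 4`

HONEST FRAMING (page 1 of everything the β sub-cell writes): discharging `BetaPertH` makes Bałaban's UV stability
UNCONDITIONAL — a real constructive-QFT result; it is NOT the continuum limit and NOT the Clay problem.  HONEST DEPENDENCY
(verbatim): «continuum YM on T⁴ ⇐ BetaPertH ∧ nine spine estimates (0/9 proved); BetaPertH ⇐ (D1) ∧ (D4) ∧ CAP+tail;
G-an2-4 gates asym, D1 and NE2/3/4.»  NOT IN PRINT; OUR PROOF.  `[folklore]` packaging of the G-an2-4 swarm's FIBRE-SIDE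
bound `GAN24.FineReadoutGradient.norm_sum_ampA_dAl_pw_le` («ONE LATTICE CURL ON THE MINIMISER LEG GAINS EXACTLY ONE 1/N»;
their header: «the position-space packaging is E3A4's with fineM/N — not repeated here») into a POSITION-SPACE statement
about `KernelSpecInstance.wH`, exactly as `GAN24.FineReadoutDecay` packages the undifferentiated bound (`exists_wH_decay`).
No cited fact, no wall binder; nothing about Bałaban's densities is asserted.  NOT summit progress.

ABSOLUTE RULE (cell charter, verbatim): "No internally-minted statement may enter as a cited fact. Every hypothesis is
either kernel-proved in this package or a verbatim quotation of a PUBLISHED theorem with page reference. The manuscript(s)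
under audit are NOT citable for their own disputed steps — they are the thing under adjudication; programme-internal
(2001/route/tribunal) claims are never citable."

## Why road P3 wants this (skeleton `HOME/beta/skeletons/D4-b2b-balaban-beta-d4-p3.md` §3 leaves E3.2/E4)

On road P3 the test configurations of [Balaban1987RG1] p. 282 are `h = N^{d+2}·wH^{(N)}` (units note
`HOME/b2b-balaban-beta-d4-p3/UNITS-E4.md`); the `|∇^η𝐀|_X` component of the (3.14)/(4.4) norm (p. 272/281) is `N·|∇h|`, so a
LEVEL-UNIFORM bound needs `|∇wH^{(N)}| ≲ N^{−(d+2)}·N⁻¹`.  This file proves it.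

## The mechanism (no case split at block boundaries)

With `z_t := proj N z`, `z_t′ := proj N (z + e_ν)`, `s := quo N (z + e_ν) − quo N z ∈ ℤ^{d+1}` (whatever it is):
`repZ z_t′ = repZ z_t + e_ν − N•s` (`BlochFibreMatrix.eq_repZ_add_zsmul_quo`), so for every alias class `m`
`e^{i p·s} · pw(k_m)(repZ z_t′) = e^{i k_{m,ν}} · pw(k_m)(repZ z_t)` (`N·k_m = p + 2π·repZ m` kills the box wrap up to the
`m`-independent phase); hence the multiplier `G := e^{i p·s}·F₁ − F₀` of the two point entries `F₁ = fibInv (inl (κ, z_t′))`,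
`F₀ = fibInv (inl (κ, z_t))` IS the alias sum `Σ_m ampA·∂̂_ν(k_m)·pw(k_m)(repZ z_t)` that `norm_sum_ampA_dAl_pw_le` bounds by
`fineM-type/N`; and `wH(z + e_ν) − wH(z) = Re latticeKernel G (quo N z)` by the phase-translation rule
(`B4Green244.latticeKernel_phase_mul`).  Paley–Wiener (`B4ContourShift.latticeKernel_decay`) finishes.
-/

noncomputable section

open Complex Finset Matrix
open scoped BigOperators Real Matrix.Norms.L2Operator
open Literature.Probability.LatticeModels (TorusSite Torus.proj)
open Literature.MathematicalPhysics.QuantumFieldTheory.LatticeForm (quo repZ)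
open Literature.MathematicalPhysics.QuantumFieldTheory.Balaban1983to89
open Literature.MathematicalPhysics.QuantumFieldTheory.Balaban1983to89.Beta
open Literature.MathematicalPhysics.QuantumFieldTheory.King1986 (aliasConst)
open AffineAveraging (Site unitVec)
open B4Strip (Strip reVec)
open B4ContourShift (BZ StripRegular latticeKernel supNorm latticeKernel_decay integrand)
open B4Green244 (phaseC latticeKernel_phase_mul)
open B4Green242Bridge (latticeKernel_sub)
open BlochFibreMatrix (Idx stencil pieceMatrix eq_repZ_add_zsmul_quo)
open FibreInverseDecay (trigPolySymbol StripHolo cphase stripHolo_cphase stripHolo_const)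
open KernelSpecInstance (wH)
open Summit.QuantumFields.BalabanUV.Beta.GAN24.ArrowOperator (arrowMat)
open Summit.QuantumFields.BalabanUV.Beta.GAN24.ArrowScaling (scaledArrow radI radO radI_pos radO_pos)
open Summit.QuantumFields.BalabanUV.Beta.GAN24.StripLegApriori (radO_zero_le_two_pi)
open Summit.QuantumFields.BalabanUV.Beta.GAN24.CombesThomasFibre (fibInv wH_eq_re_latticeKernel)
open Summit.QuantumFields.BalabanUV.Beta.GAN24.StripRegularPackaging (stripRegular_of_stripHolo stripHolo_fibInv
  stripRegular_fibInv)
open Summit.QuantumFields.BalabanUV.Beta.GAN24.FibreDetStripHolds (exists_strip strip_mono)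
open Summit.QuantumFields.BalabanUV.Beta.GAN24.FibreSymbols (pw dhat pw_add pw_add_unitVec)
open Summit.QuantumFields.BalabanUV.Beta.GAN24.FibreDFT (kFine)
open Summit.QuantumFields.BalabanUV.Beta.GAN24.FibreDFTDictionary (ampA boxData_inl_eq_sum)
open Summit.QuantumFields.BalabanUV.Beta.GAN24.AliasObjects (dAl)
open Summit.QuantumFields.BalabanUV.Beta.GAN24.FineReadoutDecay (kingFactor fineM one_le_kingFactor fineM_nonneg
  norm_fibInv_inl_inr_le_fineM aliasConst_nonneg)
open Summit.QuantumFields.BalabanUV.Beta.GAN24.FineReadoutGradient (norm_sum_ampA_dAl_pw_le)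

namespace Summit.QuantumFields.BalabanUV.Beta.RemainderExplicitGradient

/-! ## §1 The box wrap of a displaced point costs an alias-independent phase -/

section Algebra

variable {d N : ℕ} [NeZero N]

/-- [folklore] `pw(k_m)(−N•s) = e^{−i p·s}` for every integer vector `s`: `N·k_m = p + 2π·repZ m` and `e^{2πi·ℤ} = 1`. -/
theorem pw_kFine_neg_zsmul (p : Fin (d + 1) → ℂ) (m : TorusSite (d + 1) N) (s : Site (d + 1)) :
    pw (kFine p m) (-((N : ℤ) • s)) = cexp (-(I * phaseC p s)) := by
  unfold pw phaseC kFine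
  have hN : (N : ℂ) ≠ 0 := by exact_mod_cast NeZero.ne N
  -- Σ_μ k_μ · (−N s_μ) = −Σ p_μ s_μ − 2π Σ (repZ m μ)(s μ)
  have hsum : ∑ μ, (p μ + 2 * π * (repZ m μ : ℂ)) / (N : ℂ) * (((-((N : ℤ) • s)) μ : ℤ) : ℂ)
      = -(∑ μ, p μ * (s μ : ℂ)) + -(2 * π * ∑ μ, ((repZ m μ * s μ : ℤ) : ℂ)) := by
    rw [← Finset.sum_neg_distrib, Finset.mul_sum, ← Finset.sum_neg_distrib, ← Finset.sum_add_distrib]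
    refine Finset.sum_congr rfl fun μ _ => ?_
    have : (((-((N : ℤ) • s)) μ : ℤ) : ℂ) = -((N : ℂ) * (s μ : ℂ)) := by
      simp
    rw [this]
    push_cast
    field_simp
    ring
  rw [hsum, mul_add, Complex.exp_add]
  have h1 : cexp (I * -(2 * π * ∑ μ, ((repZ m μ * s μ : ℤ) : ℂ))) = 1 := by
    rw [show I * -(2 * π * ∑ μ, ((repZ m μ * s μ : ℤ) : ℂ)) = ((-(∑ μ, repZ m μ * s μ) : ℤ) : ℂ) * (2 * π * I) by
      push_cast; ring]
    exact Complex.exp_int_mul_two_pi_mul_I _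
  rw [h1, mul_one, mul_neg]

/-- [folklore] **THE DISPLACED BOX POINT**: `repZ (proj (z + e_ν)) = repZ (proj z) + e_ν − N•(quo(z + e_ν) − quo z)`. -/
theorem repZ_proj_add_unitVec (z : Site (d + 1)) (ν : Fin (d + 1)) :
    repZ (Torus.proj N (z + unitVec ν))
      = repZ (Torus.proj N z) + unitVec ν - (N : ℤ) • (quo N (z + unitVec ν) - quo N z) := by
  have h1 := eq_repZ_add_zsmul_quo (N := N) (z + unitVec ν)
  have h0 := eq_repZ_add_zsmul_quo (N := N) z
  -- from z + e_ν = repZ' + N•quo' and z = repZ + N•quo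
  have h1' : repZ (Torus.proj N (z + unitVec ν)) = (z + unitVec ν) - (N : ℤ) • quo N (z + unitVec ν) :=
    eq_sub_of_add_eq h1.symm
  have h0' : z - (N : ℤ) • quo N z = repZ (Torus.proj N z) := (sub_eq_of_eq_add h0)
  rw [h1', smul_sub, ← h0']
  abel

/-- [folklore] **THE PHASE IDENTITY, alias by alias**: with `s = quo(z + e_ν) − quo z`,
`e^{i p·s} · pw(k_m)(repZ (proj (z + e_ν))) = e^{i k_{m,ν}} · pw(k_m)(repZ (proj z))`. -/
theorem cphase_mul_pw_displaced (p : Fin (d + 1) → ℂ) (m : TorusSite (d + 1) N) (z : Site (d + 1)) (ν : Fin (d + 1)) :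
    cexp (I * phaseC p (quo N (z + unitVec ν) - quo N z)) * pw (kFine p m) (repZ (Torus.proj N (z + unitVec ν)))
      = cexp (I * kFine p m ν) * pw (kFine p m) (repZ (Torus.proj N z)) := by
  set s : Site (d + 1) := quo N (z + unitVec ν) - quo N z with hs
  rw [repZ_proj_add_unitVec z ν, ← hs,
    show repZ (Torus.proj N z) + unitVec ν - (N : ℤ) • s = repZ (Torus.proj N z) + unitVec ν + -((N : ℤ) • s) from
      sub_eq_add_neg _ _,
    pw_add, pw_add_unitVec, pw_kFine_neg_zsmul]
  have hcancel : cexp (I * phaseC p s) * cexp (-(I * phaseC p s)) = 1 := by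
    rw [← Complex.exp_add, add_neg_cancel, Complex.exp_zero]
  calc cexp (I * phaseC p s) * (cexp (I * kFine p m ν) * pw (kFine p m) (repZ (Torus.proj N z)) * cexp (-(I * phaseC p s)))
      = (cexp (I * phaseC p s) * cexp (-(I * phaseC p s))) * (cexp (I * kFine p m ν) * pw (kFine p m) (repZ (Torus.proj N z))) := by
        ring
    _ = cexp (I * kFine p m ν) * pw (kFine p m) (repZ (Torus.proj N z)) := by rw [hcancel, one_mul]

/-- The DIFFERENCE MULTIPLIER of the two point entries of the minimiser column, with the box-wrap phase:
`G(p) = e^{i p·s} · fibInv (inl (κ, proj (z + e_ν))) (inr (inr l)) p − fibInv (inl (κ, proj z)) (inr (inr l)) p`. [folklore] -/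
def gradMult (N : ℕ) [NeZero N] (κ l ν : Fin (d + 1)) (z : Site (d + 1)) (p : Fin (d + 1) → ℂ) : ℂ :=
  cexp (I * phaseC p (quo N (z + unitVec ν) - quo N z)) *
      fibInv N (Sum.inl (κ, Torus.proj N (z + unitVec ν))) (Sum.inr (Sum.inr l)) p
    - fibInv N (Sum.inl (κ, Torus.proj N z)) (Sum.inr (Sum.inr l)) p

/-- [folklore] **THE DIFFERENCE MULTIPLIER IS THE CURLED ALIAS SUM**:
`G(p) = Σ_m ampA p v m κ · ∂̂_ν(k_m) · pw(k_m)(repZ (proj z))` for the column `v = fibInv N · (inr (inr l)) p` (plane-wave synthesis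
`boxData_inl_eq_sum` of both entries + the phase identity). -/
theorem gradMult_eq_sum (κ l ν : Fin (d + 1)) (z : Site (d + 1)) (p : Fin (d + 1) → ℂ) :
    gradMult N κ l ν z p
      = ∑ m : TorusSite (d + 1) N,
          ampA p (fun i => fibInv N i (Sum.inr (Sum.inr l)) p) m κ * dAl N p m ν * pw (kFine p m) (repZ (Torus.proj N z)) := by
  unfold gradMult
  set v : Idx (d + 1) N → ℂ := fun i => fibInv N i (Sum.inr (Sum.inr l)) p with hv
  have h1 : fibInv N (Sum.inl (κ, Torus.proj N (z + unitVec ν))) (Sum.inr (Sum.inr l)) p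
      = ∑ m : TorusSite (d + 1) N, ampA p v m κ * pw (kFine p m) (repZ (Torus.proj N (z + unitVec ν))) :=
    boxData_inl_eq_sum p v κ _
  have h0 : fibInv N (Sum.inl (κ, Torus.proj N z)) (Sum.inr (Sum.inr l)) p
      = ∑ m : TorusSite (d + 1) N, ampA p v m κ * pw (kFine p m) (repZ (Torus.proj N z)) :=
    boxData_inl_eq_sum p v κ _
  rw [h1, h0, Finset.mul_sum, ← Finset.sum_sub_distrib]
  refine Finset.sum_congr rfl fun m _ => ?_
  have hph := cphase_mul_pw_displaced p m z ν
  -- e^{ip·s}·(a·pw′) − a·pw = a·(e^{ik_ν} − 1)·pw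
  calc cexp (I * phaseC p (quo N (z + unitVec ν) - quo N z)) * (ampA p v m κ * pw (kFine p m) (repZ (Torus.proj N (z + unitVec ν))))
        - ampA p v m κ * pw (kFine p m) (repZ (Torus.proj N z))
      = ampA p v m κ * (cexp (I * phaseC p (quo N (z + unitVec ν) - quo N z)) * pw (kFine p m) (repZ (Torus.proj N (z + unitVec ν))))
        - ampA p v m κ * pw (kFine p m) (repZ (Torus.proj N z)) := by ring
    _ = ampA p v m κ * (cexp (I * kFine p m ν) * pw (kFine p m) (repZ (Torus.proj N z)))
        - ampA p v m κ * pw (kFine p m) (repZ (Torus.proj N z)) := by rw [hph]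
    _ = ampA p v m κ * dAl N p m ν * pw (kFine p m) (repZ (Torus.proj N z)) := by
        rw [show dAl N p m ν = cexp (I * kFine p m ν) - 1 from rfl]; ring

end Algebra

/-! ## §2 The difference multiplier on the strip: holomorphy and the `1/N`-improved bound -/

section StripBound

variable {d N : ℕ} [NeZero N]

/-- [folklore] `G` is strip holomorphic wherever the fibre determinant has no zero on the strip (phase · entry − entry). -/
theorem stripHolo_gradMult {κ₀ : ℝ} (hκ : 0 ≤ κ₀)
    (hdet : ∀ p ∈ Strip (d + 1) κ₀, (trigPolySymbol (stencil (d + 1)) (pieceMatrix (N := N)) p).det ≠ 0)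
    (κ l ν : Fin (d + 1)) (z : Site (d + 1)) : StripHolo (gradMult N κ l ν z) κ₀ := by
  have hph : StripHolo (fun p : Fin (d + 1) → ℂ => cexp (I * phaseC p (quo N (z + unitVec ν) - quo N z))) κ₀ :=
    stripHolo_cphase (quo N (z + unitVec ν) - quo N z) κ₀
  have h1 := hph.mul (stripHolo_fibInv hκ hdet (Sum.inl (κ, Torus.proj N (z + unitVec ν))) (Sum.inr (Sum.inr l)))
  have h0 := (stripHolo_const (-1 : ℂ) κ₀).mul (stripHolo_fibInv hκ hdet (Sum.inl (κ, Torus.proj N z)) (Sum.inr (Sum.inr l)))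
  have h := h1.add h0
  have hfun : gradMult N κ l ν z = fun p => cexp (I * phaseC p (quo N (z + unitVec ν) - quo N z)) *
        fibInv N (Sum.inl (κ, Torus.proj N (z + unitVec ν))) (Sum.inr (Sum.inr l)) p
      + (-1) * fibInv N (Sum.inl (κ, Torus.proj N z)) (Sum.inr (Sum.inr l)) p := by
    funext p; unfold gradMult; ring
  rw [hfun]
  exact h

/-- [folklore] The `1/N`-improved King factor of the gradient: `π + 1 + 15·K_D·(R₀²·C₀ + R₀³·C₋₁)`. -/
def gradKingFactor (d : ℕ) (R0 : ℝ) : ℝ :=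
  π + 1 + 15 * (Real.sqrt 12 ^ (d + 1) * (Real.sqrt 6 * (1 + 8 * (d + 1 : ℕ)))) *
    (R0 ^ 2 * ((3 * π) ^ (1 - (0 : ℝ)) * (3 : ℝ) ^ (d + 1) * aliasConst (d + 1) 0)
      + R0 ^ 3 * ((3 * π) ^ (1 - (-1 : ℝ)) * (3 : ℝ) ^ (d + 1) * aliasConst (d + 1) (-1)))

/-- [folklore] THE SUP BOUND OF THE DIFFERENCE MULTIPLIER at block side `N`: `gradM = e^{(d+1)κ₀}·A·(N^{d+2})⁻¹·N⁻¹·gradKingFactor d R₀`. -/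
def gradM (d N : ℕ) (κ₀ A R0 : ℝ) : ℝ :=
  Real.exp ((d + 1) * κ₀) * A * ((N : ℝ) ^ (d + 1 + 1))⁻¹ * (N : ℝ)⁻¹ * gradKingFactor d R0

/-- [folklore] `gradKingFactor` is nonnegative and monotone in the radius envelope on `[0, ∞)`. -/
theorem gradKingFactor_mono {R0 R0' : ℝ} (h0 : 0 ≤ R0) (h : R0 ≤ R0') : gradKingFactor d R0 ≤ gradKingFactor d R0' := by
  unfold gradKingFactor
  have hC0 : 0 ≤ (3 * π) ^ (1 - (0 : ℝ)) * (3 : ℝ) ^ (d + 1) * aliasConst (d + 1) 0 :=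
    mul_nonneg (by positivity) (aliasConst_nonneg (Nat.succ_pos d) (by norm_num))
  have hC1 : 0 ≤ (3 * π) ^ (1 - (-1 : ℝ)) * (3 : ℝ) ^ (d + 1) * aliasConst (d + 1) (-1) :=
    mul_nonneg (by positivity) (aliasConst_nonneg (Nat.succ_pos d) (by norm_num))
  have h2 : R0 ^ 2 ≤ R0' ^ 2 := pow_le_pow_left₀ h0 h 2
  have h3 : R0 ^ 3 ≤ R0' ^ 3 := pow_le_pow_left₀ h0 h 3
  have hK : 0 ≤ 15 * (Real.sqrt 12 ^ (d + 1) * (Real.sqrt 6 * (1 + 8 * (d + 1 : ℕ)))) := by positivity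
  nlinarith [mul_le_mul_of_nonneg_right h2 hC0, mul_le_mul_of_nonneg_right h3 hC1]

/-- [folklore] `0 ≤ gradKingFactor d R₀` for `R₀ ≥ 0`. -/
theorem gradKingFactor_nonneg {R0 : ℝ} (h0 : 0 ≤ R0) : 0 ≤ gradKingFactor d R0 := by
  unfold gradKingFactor
  have hC0 : 0 ≤ (3 * π) ^ (1 - (0 : ℝ)) * (3 : ℝ) ^ (d + 1) * aliasConst (d + 1) 0 :=
    mul_nonneg (by positivity) (aliasConst_nonneg (Nat.succ_pos d) (by norm_num))
  have hC1 : 0 ≤ (3 * π) ^ (1 - (-1 : ℝ)) * (3 : ℝ) ^ (d + 1) * aliasConst (d + 1) (-1) :=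
    mul_nonneg (by positivity) (aliasConst_nonneg (Nat.succ_pos d) (by norm_num))
  positivity

omit [NeZero N] in
/-- [folklore] `0 ≤ gradM`. -/
theorem gradM_nonneg {κ₀ A R0 : ℝ} (hA : 0 ≤ A) (hR0 : 0 ≤ R0) : 0 ≤ gradM d N κ₀ A R0 := by
  unfold gradM
  have := gradKingFactor_nonneg (d := d) hR0
  positivity

/-- [folklore] AT A STRIP POINT WITH A SCALED A-PRIORI PAIR OF BORDER RADIUS `r₀ ≤ R₀`: `‖G(p)‖ ≤ gradM d N κ₀ A R₀`
(the curled alias sum of `FineReadoutGradient` through `gradMult_eq_sum`). -/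
theorem norm_gradMult_le_gradM {κ₀ A R0 : ℝ} (hκ : 0 ≤ κ₀) (hκ4 : κ₀ ≤ 1 / 4) (hκD : (3 * (d + 1 : ℕ) / 2 + 2) * κ₀ ≤ 1 / 2)
    (hA : 0 ≤ A) {p : Fin (d + 1) → ℂ} (hp : p ∈ Strip (d + 1) κ₀)
    (hdet : (trigPolySymbol (stencil (d + 1)) (pieceMatrix (N := N)) p).det ≠ 0)
    {r : TorusSite (d + 1) N → ℝ} (hr : ∀ m, 0 < r m) {r0 : ℝ} (hr0 : 0 < r0) (hr0R : r0 ≤ R0)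
    (hU : IsUnit (arrowMat (scaledArrow N r r0 p))) (hAi : ‖(arrowMat (scaledArrow N r r0 p))⁻¹‖ ≤ A)
    (κ l ν : Fin (d + 1)) (z : Site (d + 1)) :
    ‖gradMult N κ l ν z p‖ ≤ gradM d N κ₀ A R0 := by
  rw [gradMult_eq_sum]
  have h := norm_sum_ampA_dAl_pw_le (fun i => (hp i).1) (fun i => (hp i).2) hκ hκ4 hκD hdet hr hr0 hA hU hAi l κ ν
    (Torus.proj N z)
  refine h.trans ?_
  unfold gradM
  have hK := gradKingFactor_mono (d := d) hr0.le hr0R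
  have hE : 0 ≤ Real.exp ((d + 1) * κ₀) * A * ((N : ℝ) ^ (d + 1 + 1))⁻¹ * (N : ℝ)⁻¹ := by positivity
  exact mul_le_mul_of_nonneg_left hK hE

/-- [folklore] **`StripRegular` OF THE DIFFERENCE MULTIPLIER WITH THE `1/N`-IMPROVED BOUND** from a det-free strip carrying scaled a-priori
pairs (inner or outer, border radius `≤ R₀`). -/
theorem stripRegular_gradMult {κ₀ A R0 : ℝ} (hκ0 : 0 < κ₀) (hκ4 : κ₀ ≤ 1 / 4) (hκD : (3 * (d + 1 : ℕ) / 2 + 2) * κ₀ ≤ 1 / 2)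
    (hA : 0 ≤ A)
    (hdet : ∀ p ∈ Strip (d + 1) κ₀, (trigPolySymbol (stencil (d + 1)) (pieceMatrix (N := N)) p).det ≠ 0)
    (hpair : ∀ p ∈ Strip (d + 1) κ₀, ∃ (r : TorusSite (d + 1) N → ℝ) (r0 : ℝ), (∀ m, 0 < r m) ∧ 0 < r0 ∧ r0 ≤ R0 ∧
      IsUnit (arrowMat (scaledArrow N r r0 p)) ∧ ‖(arrowMat (scaledArrow N r r0 p))⁻¹‖ ≤ A)
    (κ l ν : Fin (d + 1)) (z : Site (d + 1)) :
    StripRegular (gradMult N κ l ν z) κ₀ (gradM d N κ₀ A R0) := by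
  refine stripRegular_of_stripHolo (stripHolo_gradMult hκ0.le hdet κ l ν z) fun p hp => ?_
  obtain ⟨r, r0, hr, hr0, hr0R, hU, hAi⟩ := hpair p hp
  exact norm_gradMult_le_gradM hκ0.le hκ4 hκD hA hp (hdet p hp) hr hr0 hr0R hU hAi κ l ν z

end StripBound

/-! ## §3 Position space: the gradient of `wH` is the lattice kernel of the difference multiplier -/

section Position

variable {d N : ℕ} [NeZero N]

/-- [folklore] **`wH(z + e_ν) − wH(z) = Re latticeKernel G (quo N z)`** — the phase-translation rule moves the block label of the displaced
point back to `quo N z` (integrability of both multipliers from their strip regularity). -/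
theorem wH_sub_eq_re_latticeKernel {κ₀ M₁ M₀ : ℝ} (hκ : 0 ≤ κ₀) (κ l ν : Fin (d + 1)) (z : Site (d + 1))
    (hG : StripRegular (gradMult N κ l ν z) κ₀ M₁)
    (hF : StripRegular (fibInv N (Sum.inl (κ, Torus.proj N z)) (Sum.inr (Sum.inr l))) κ₀ M₀) :
    wH (N := N) κ l (z + unitVec ν) - wH (N := N) κ l z = (latticeKernel (gradMult N κ l ν z) (quo N z)).re := by
  rw [wH_eq_re_latticeKernel, wH_eq_re_latticeKernel, ← Complex.sub_re]
  congr 1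
  set s : Site (d + 1) := quo N (z + unitVec ν) - quo N z with hs
  have hquo : quo N (z + unitVec ν) = quo N z + s := by rw [hs]; abel
  -- translate the displaced entry back to the block label `quo N z`
  have hshift : latticeKernel (fibInv N (Sum.inl (κ, Torus.proj N (z + unitVec ν))) (Sum.inr (Sum.inr l))) (quo N (z + unitVec ν))
      = latticeKernel (fun P => cexp (I * phaseC P s) *
          fibInv N (Sum.inl (κ, Torus.proj N (z + unitVec ν))) (Sum.inr (Sum.inr l)) P) (quo N z) := by
    rw [hquo, ← latticeKernel_phase_mul]
  rw [hshift]
  -- linearity of the lattice kernel (integrability: `G` and `F₀` strip-regular, the shifted entry = G + F₀)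
  have hI0 := hF.integrableOn hκ (quo N z)
  have hIG := hG.integrableOn hκ (quo N z)
  have hI1 : MeasureTheory.IntegrableOn (integrand (fun P => cexp (I * phaseC P s) *
      fibInv N (Sum.inl (κ, Torus.proj N (z + unitVec ν))) (Sum.inr (Sum.inr l)) P) (quo N z)) (BZ (d + 1)) := by
    have hfun : integrand (fun P => cexp (I * phaseC P s) *
        fibInv N (Sum.inl (κ, Torus.proj N (z + unitVec ν))) (Sum.inr (Sum.inr l)) P) (quo N z)
        = fun q => integrand (gradMult N κ l ν z) (quo N z) q
          + integrand (fibInv N (Sum.inl (κ, Torus.proj N z)) (Sum.inr (Sum.inr l))) (quo N z) q := by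
      funext q
      simp only [integrand, gradMult, hs]
      ring
    rw [hfun]
    exact hIG.add hI0
  rw [← latticeKernel_sub (quo N z) hI1 hI0]
  rfl

/-- [folklore] **THE GRADIENT BOUND AT BLOCK SIDE `N`** (Paley–Wiener on the block label):
`|wH(z + e_ν) − wH(z)| ≤ gradM · e^{−κ₀‖quo N z‖∞}` for EVERY fine bond `(κ, z)` and direction `ν`. -/
theorem abs_wH_sub_le {κ₀ A R0 : ℝ} (hκ0 : 0 < κ₀) (hκ4 : κ₀ ≤ 1 / 4) (hκD : (3 * (d + 1 : ℕ) / 2 + 2) * κ₀ ≤ 1 / 2)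
    (hA : 0 ≤ A)
    (hdet : ∀ p ∈ Strip (d + 1) κ₀, (trigPolySymbol (stencil (d + 1)) (pieceMatrix (N := N)) p).det ≠ 0)
    (hpair : ∀ p ∈ Strip (d + 1) κ₀, ∃ (r : TorusSite (d + 1) N → ℝ) (r0 : ℝ), (∀ m, 0 < r m) ∧ 0 < r0 ∧ r0 ≤ R0 ∧
      IsUnit (arrowMat (scaledArrow N r r0 p)) ∧ ‖(arrowMat (scaledArrow N r r0 p))⁻¹‖ ≤ A)
    (κ l ν : Fin (d + 1)) (z : Site (d + 1)) :
    |wH (N := N) κ l (z + unitVec ν) - wH (N := N) κ l z| ≤ gradM d N κ₀ A R0 * Real.exp (-(κ₀ * supNorm (quo N z))) := by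
  have hG := stripRegular_gradMult hκ0 hκ4 hκD hA hdet hpair κ l ν z
  have hF : StripRegular (fibInv N (Sum.inl (κ, Torus.proj N z)) (Sum.inr (Sum.inr l))) κ₀ (fineM d N κ₀ A R0) := by
    refine stripRegular_fibInv hκ0.le hdet _ _ fun p hp => ?_
    obtain ⟨r, r0, hr, hr0, hr0R, hU, hAi⟩ := hpair p hp
    exact norm_fibInv_inl_inr_le_fineM hκ0.le hκ4 hκD hA hp (hdet p hp) hr hr0 hr0R hU hAi l κ _
  rw [wH_sub_eq_re_latticeKernel hκ0.le κ l ν z hG hF]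
  refine (Complex.abs_re_le_norm _).trans ?_
  exact latticeKernel_decay hG hκ0.le _

end Position

/-! ## §4 `d = 3`: the level-uniform gradient bound, unconditionally, from road P1's (U1)+A -/

section Four

variable {Lc : ℕ} [NeZero Lc]

/-- [folklore] **SKELETON LEAF E3.2 OF ROAD P3, UNCONDITIONAL AT `d + 1 = 4`**: ONE rate `κ₀ > 0` and ONE constant `C` such that for EVERY
level `N = Lc^(j+1)`, every fine bond `(κ, z)`, every source direction `l` and every lattice direction `ν`,
`|wH (N := Lc^(j+1)) κ l (z + e_ν) − wH κ l z| ≤ C · ((Lc^(j+1))^5)⁻¹ · (Lc^(j+1))⁻¹ · e^{−κ₀‖quo (Lc^(j+1)) z‖∞}` — the lattice gradient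
of the fine minimiser column of Bałaban's typed `U = 1` block-spin map is `O(N^{−(d+2)}·N⁻¹)` pointwise with exponential decay on
the BLOCK scale, uniformly in the level (inputs: `GAN24.FibreDetStripHolds.exists_strip` and `GAN24.FineReadoutGradient` BY NAME).
Read through the units dictionary of road P3 (`h = N^5·wH`, `∇^η = N·∇`): the `|∇^η𝐀|_X` component of the (4.4)-norm of the test
configuration is LEVEL-UNIFORMLY bounded. -/
theorem exists_dwH_decay :
    ∃ κ₀ C : ℝ, 0 < κ₀ ∧ 0 ≤ C ∧ ∀ (j : ℕ) (κ l ν : Fin 4) (z : Fin 4 → ℤ),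
      |wH (N := Lc ^ (j + 1)) κ l (z + unitVec ν) - wH (N := Lc ^ (j + 1)) κ l z|
        ≤ C * (((Lc ^ (j + 1) : ℕ) : ℝ) ^ 5)⁻¹ * (((Lc ^ (j + 1) : ℕ) : ℝ))⁻¹ *
          Real.exp (-(κ₀ * supNorm (quo (Lc ^ (j + 1)) z))) := by
  obtain ⟨ρ₀, κ₀, A, hρ₀, hκ₀, _hκρ, hκ4, hA, hdet, hpair⟩ := exists_strip (d := 3) (Lc := Lc)
  -- shrink the strip so that E3A2's relative bound applies: (3·4/2 + 2)·κ₁ ≤ 1/2, i.e. κ₁ ≤ 1/16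
  set κ₁ : ℝ := min κ₀ (1 / 16) with hκ₁
  have hκ₁0 : 0 < κ₁ := lt_min hκ₀ (by norm_num)
  have hκ₁le : κ₁ ≤ κ₀ := min_le_left _ _
  have hκ₁4 : κ₁ ≤ 1 / 4 := (min_le_right _ _).trans (by norm_num)
  have hκ₁D : (3 * (3 + 1 : ℕ) / 2 + 2) * κ₁ ≤ 1 / 2 := by
    have := min_le_right κ₀ (1 / 16 : ℝ); push_cast; nlinarith
  set R0 : ℝ := 2 * π with hR0
  have hR0pos : 0 < R0 := by rw [hR0]; positivity
  refine ⟨κ₁, Real.exp ((3 + 1) * κ₁) * A * gradKingFactor 3 R0, hκ₁0, ?_, fun j κ l ν z => ?_⟩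
  · have := gradKingFactor_nonneg (d := 3) hR0pos.le; positivity
  haveI : NeZero (Lc ^ (j + 1)) := ⟨pow_ne_zero _ (NeZero.ne Lc)⟩
  have hdet₁ : ∀ p ∈ Strip (3 + 1) κ₁, (trigPolySymbol (stencil (3 + 1)) (pieceMatrix (N := Lc ^ (j + 1))) p).det ≠ 0 :=
    strip_mono hκ₁le (hdet j)
  have hpair₁ : ∀ p ∈ Strip (3 + 1) κ₁, ∃ (r : TorusSite (3 + 1) (Lc ^ (j + 1)) → ℝ) (r0 : ℝ), (∀ m, 0 < r m) ∧ 0 < r0 ∧ r0 ≤ R0 ∧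
      IsUnit (arrowMat (scaledArrow (Lc ^ (j + 1)) r r0 p)) ∧ ‖(arrowMat (scaledArrow (Lc ^ (j + 1)) r r0 p))⁻¹‖ ≤ A := by
    intro p hp
    have hq : ∀ i, |reVec p i| ≤ π := fun i => (hp i).1
    rcases strip_mono hκ₁le (hpair j) p hp with ⟨_, hU, hAi⟩ | ⟨_, _, hq0, hU, hAi⟩
    · refine ⟨radI (Lc ^ (j + 1)), 1, radI_pos, one_pos, ?_, hU, hAi⟩
      rw [hR0]; have := Real.pi_gt_three; linarith
    · exact ⟨radO (Lc ^ (j + 1)) (reVec p), radO (Lc ^ (j + 1)) (reVec p) 0, radO_pos hq hq0, radO_pos hq hq0 0,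
        radO_zero_le_two_pi hq, hU, hAi⟩
  have h := abs_wH_sub_le (N := Lc ^ (j + 1)) hκ₁0 hκ₁4 hκ₁D hA hdet₁ hpair₁ κ l ν z
  refine h.trans (le_of_eq ?_)
  unfold gradM
  push_cast
  ring

end Four

end Summit.QuantumFields.BalabanUV.Beta.RemainderExplicitGradient

end
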